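import Summits.NavierStokesRegularity.NavierStokesRegularity.Theses.CertifiedBlowup

/-!
# Route CertifiedBlowup — `CertifiedBlowupRateGlue` (item stmt-NavierStokesRegularity-8641)

Pure logic: crux #3 `CertifiedBlowupVorticityRateBlowup` (a maximal Leray–Hopf classical solution
from a rapidly decaying axisymmetric datum with finite lifespan `T` obeying the vorticity rate
`(T - t) ‖ω(t)‖_∞ ≤ C` as `t ↑ T`) implies crux #2 `CertifiedBlowupAxisymBlowup` (the same
existential statement without the rate conjunct): forget the last conjunct of the witness.
-/

set_option linter.dupNamespace false

namespace Summit.NavierStokesRegularity.NavierStokesRegularity.Theorems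

open Summit.NavierStokesRegularity.NavierStokesRegularity.Theses.CertifiedBlowup

/-- **RateGlue** (item stmt-NavierStokesRegularity-8641, route CertifiedBlowup): the certificate
class `#3` (axisymmetric finite-lifespan Leray–Hopf classical solution with vorticity rate
`(T - t) ‖curl (u t) x‖ ≤ C` eventually as `t ↑ T`) implies `#2` (axisymmetric finite-time
blow-up) — keep the witness `(ν, T, u, p)` and drop the rate conjunct. -/
theorem certifiedBlowup_rateGlue_proof : CertifiedBlowupRateGlue := by
  unfold CertifiedBlowupRateGlue
  rintro ⟨ν, hν, T, hT, u, p, hmax, hLH, hdec, hax, -⟩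
  exact ⟨ν, hν, T, hT, u, p, hmax, hLH, hdec, hax⟩

end Summit.NavierStokesRegularity.NavierStokesRegularity.Theorems
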